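/-
Copyright (c) 2026 the pub-hodgecm-mathlib formalisation cell (harness21).  Prover seat hodgecm-mathlib-K2E1-p09 (g4), Track B ∕ K2-LIT,
h413 = `stmt-HodgeConjecture-24833`, line `K2_E1_TraceFormulaBeta`, campaign RES-RANK-ONE (toward (H4-b)): the `ℂ`-valued (Bochner) twin of ★ p857228
`K2E1PseudoEisensteinConstantTerm`.  DEAL of the dealer K2E1-plan (g2) 2026-09-04T04:06:21Z (ii).
-/
import Summits.HodgeConjecture.HodgeConjecture.Theorems.K2E1PseudoEisensteinConstantTerm   -- ★ p857228 (this seat): the `[0,∞]` formula and its cells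
import Mathlib.MeasureTheory.Integral.DominatedConvergence
import HarnessLib

/-!
# h413 ∕ Track B «K2-LIT», campaign RES-RANK-ONE — helper `K2E1PseudoEisensteinConstantTermC`: the rank-one constant term of a `ℂ`-valued pseudo-Eisenstein series,
# `∫_{u∈𝓕} θ_Φ(x u⁻¹) dν = ν(𝓕)·Σ'_{t∈T} Φ(x t) + Σ'_{t∈T} ∫_N Φ(x v t w₀) dν(v)` under `∫⁻_𝓕 θ_{‖Φ‖}(x u⁻¹) dν < ∞`

Cell `pub/hodgecm-mathlib`, crux H413 = `stmt-HodgeConjecture-24833`, route `HCCMUnconditional`; chair K2-lead (g0), dealer K2E1-plan (g2).  THEOREMS ONLY (no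
`def`, no `instance`, no `notation`, no named-fact hypothesis, no `sorry`); lane `--kind proof --supports stmt-HodgeConjecture-24833 --as helper` (count-neutral).

Same generic setting as ★ p857228 (`G` second countable, `Γ ≤ G` discrete, `N ≤ G` with a left- and inversion-invariant `ν` and a measurable fundamental domain `𝓕` of `Γ ∩ N`,
`T ≤ Γ` with `t⁻¹ N t ⊆ N`, `w₀ ∈ Γ`, the coset form `e : ↥T × Option ↥(Γ∩N) ≃ Γ ⧸ Γ∩N` of the Bruhat decomposition), now for a Borel right-`N`-invariant `Φ : G → ℂ` under the
ONE finiteness binder `hfin : ∫⁻_{u ∈ 𝓕} Σ'_q ‖Φ(x u⁻¹ q̃)‖ₑ dν < ∞` (the `[0,∞]` constant term of `θ_{‖Φ‖}` at `x`, computed by ★ p857228 — so `hfin` is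
«`ν(𝓕)·Σ_t ‖Φ(x t)‖ + Σ_t ∫_N ‖Φ(x v t w₀)‖ < ∞`»):
* §1 bookkeeping: `tsum_option_eq_of_summable`, `apply_mul_out_mk_eq'` (any codomain), the cell dictionary `apply_mul_out_equiv_eq`;
* §2 the `[0,∞]` identity `tsum_lintegral_cells_eq` (`Σ'_p ∫⁻_𝓕 ‖Φ(x u⁻¹ · cell p)‖ₑ = ∫⁻_𝓕 θ_{‖Φ‖}(x u⁻¹)`), **`integrable_bigCell`** (`v ↦ Φ(x v t w₀)` is `ν`-integrable on
  `N`), THE FORMULA **`setIntegral_tsum_quotient_eq`** and its `G ⧸ Γ` spelling **`setIntegral_tsum_quotient_mk_eq`** (★ F2a `tsum_quotient_mul_coe_eq`):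
  `∫_{u ∈ 𝓕} θ_Φ(x u⁻¹) dν = (ν 𝓕).toReal • Σ'_{t ∈ T} Φ(x t) + Σ'_{t ∈ T} ∫_N Φ(x v t w₀) dν(v)` [MW1995 II.1.7] — what `E_B(φ_s) = φ_s + M(s)φ_s` consumes
  (`integral_tsum` for the absolutely convergent `q`-sum, `Equiv.tsum_eq e`, `Summable.tsum_prod'`, the small cell `∫_𝓕 Φ(x u⁻¹ t) = ν(𝓕)·Φ(x t)`, the big cell by
  Mathlib `IsFundamentalDomain.integral_eq_tsum''` + `integral_inv_eq_self`).

HONEST LABEL.  Count-neutral helper; proves no printed statement; HC_CM is proved only modulo the 7 printed citations (2 remaining named inputs: hLiu418 =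
`stmt-HodgeConjecture-24832`, h413 = `stmt-HodgeConjecture-24833`) until rung 0 closes.

## References
* [MoeglinWaldspurger1995] C. Mœglin, J.-L. Waldspurger, *Spectral decomposition and Eisenstein series* (1995), II.1.7, I.2.6.
* [Garrett2018] P. Garrett, *Modern Analysis of Automorphic Forms by Example* 1 (2018), §1.9.
-/

set_option autoImplicit false
set_option linter.dupNamespace false  -- the mandated namespace repeats the summit's segment (`HodgeConjecture.HodgeConjecture`)

noncomputable section
open MeasureTheory Measure Set Filter Topology
open Summit.HodgeConjecture.HodgeConjecture.Cruxes.H413.K2E1PseudoEisensteinUnfolding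
open Summit.HodgeConjecture.HodgeConjecture.Cruxes.H413.K2E1PseudoEisensteinConstantTerm
open Summit.HodgeConjecture.HodgeConjecture.Cruxes.H413.K2E1PseudoEisensteinAdjunction (tsum_quotient_mul_coe_eq)
open scoped ENNReal NNReal Pointwise

namespace Summit.HodgeConjecture.HodgeConjecture.Cruxes.H413.K2E1PseudoEisensteinConstantTermC

/-! ## §1 Bookkeeping -/

section Bookkeeping

/-- `Σ'_{o : Option α} f o = f none + Σ'_a f (some a)` for a SUMMABLE family in a complete normed group. [folklore] -/
theorem tsum_option_eq_of_summable {α M : Type*} [NormedAddCommGroup M] [CompleteSpace M] (f : Option α → M) (hf : Summable f) :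
    ∑' o, f o = f none + ∑' a, f (some a) := by
  rw [← (Equiv.optionEquivSumPUnit α : Option α ≃ α ⊕ PUnit.{1}).symm.tsum_eq f]
  have h1 : Summable ((fun s : α ⊕ PUnit.{1} => f ((Equiv.optionEquivSumPUnit α : Option α ≃ α ⊕ PUnit.{1}).symm s)) ∘ Sum.inl) := by
    have : ((fun s : α ⊕ PUnit.{1} => f ((Equiv.optionEquivSumPUnit α : Option α ≃ α ⊕ PUnit.{1}).symm s)) ∘ Sum.inl) = fun a => f (some a) := by
      funext a; simp
    rw [this]
    exact hf.comp_injective (Option.some_injective α)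
  have h2 : Summable ((fun s : α ⊕ PUnit.{1} => f ((Equiv.optionEquivSumPUnit α : Option α ≃ α ⊕ PUnit.{1}).symm s)) ∘ Sum.inr) :=
    (hasSum_fintype _).summable
  rw [h1.tsum_sum h2, add_comm]
  simp

variable {G : Type*} [Group G] (Γ N : Subgroup G)

/-- Representative independence for ANY codomain: `Φ(g · [γ].out) = Φ(g γ)` for right-`N`-invariant `Φ`, `γ ∈ Γ`. [folklore] -/
theorem apply_mul_out_mk_eq' {α : Type*} {Φ : G → α} (hΦ : ∀ (g : G) (n : N), Φ (g * n) = Φ g) (g : G) (γ : Γ) :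
    Φ (g * (((QuotientGroup.mk γ : Γ ⧸ N.subgroupOf Γ).out : Γ) : G)) = Φ (g * (γ : G)) := by
  obtain ⟨h, hh⟩ := QuotientGroup.mk_out_eq_mul (N.subgroupOf Γ) γ
  rw [hh, Subgroup.coe_mul, ← mul_assoc]
  exact hΦ (g * (γ : G)) ⟨((h : Γ) : G), h.2⟩

/-- The cell dictionary: under `e`, `Φ(g · (e p).out)` is `Φ(g t)` on `(t, none)` and `Φ(g · n t w₀)` on `(t, some n)`. [cite: MoeglinWaldspurger1995, II.1.7] -/
theorem apply_mul_out_equiv_eq {α : Type*} {Φ : G → α} (hΦ : ∀ (g : G) (n : N), Φ (g * n) = Φ g) {T : Subgroup Γ} {w : Γ}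
    (e : ↥T × Option ↥(N.subgroupOf Γ) ≃ Γ ⧸ N.subgroupOf Γ) (he₁ : ∀ t : T, e (t, none) = ((t : Γ) : Γ ⧸ N.subgroupOf Γ))
    (he₂ : ∀ (t : T) (n : N.subgroupOf Γ), e (t, some n) = (((n : Γ) * t * w : Γ) : Γ ⧸ N.subgroupOf Γ)) (g : G) (p : ↥T × Option ↥(N.subgroupOf Γ)) :
    Φ (g * ((e p).out : G)) = Φ (g * p.2.elim (((p.1 : Γ)) : G) fun n => ((n : Γ) : G) * ((p.1 : Γ) : G) * (w : G)) := by
  obtain ⟨t, _ | n⟩ := p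
  · rw [he₁, apply_mul_out_mk_eq' Γ N hΦ]; rfl
  · rw [he₂, apply_mul_out_mk_eq' Γ N hΦ, Subgroup.coe_mul, Subgroup.coe_mul]; rfl

end Bookkeeping

/-! ## §2 The `ℂ`-valued constant term -/

section ConstantTermC

variable {G : Type*} [Group G] [TopologicalSpace G] [IsTopologicalGroup G] [MeasurableSpace G] [BorelSpace G] [SecondCountableTopology G]
  (Γ N : Subgroup G) [DiscreteTopology Γ] (νN : Measure N) [νN.IsMulLeftInvariant] [νN.IsInvInvariant]

omit [DiscreteTopology Γ] [νN.IsMulLeftInvariant] [νN.IsInvInvariant] in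
/-- The `[0,∞]` bookkeeping behind the finiteness binder: `Σ'_p ∫⁻_𝓕 ‖Φ(x u⁻¹ · rep p)‖ₑ dν = ∫⁻_𝓕 θ_{‖Φ‖}(x u⁻¹) dν` (Tonelli + the cell dictionary).
[cite: MoeglinWaldspurger1995, II.1.7] -/
theorem tsum_lintegral_cells_eq [Countable (Γ ⧸ N.subgroupOf Γ)] {Φ : G → ℂ} (hΦm : Measurable Φ) (hΦ : ∀ (g : G) (n : N), Φ (g * n) = Φ g)
    {T : Subgroup Γ} {w : Γ} (e : ↥T × Option ↥(N.subgroupOf Γ) ≃ Γ ⧸ N.subgroupOf Γ) (he₁ : ∀ t : T, e (t, none) = ((t : Γ) : Γ ⧸ N.subgroupOf Γ))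
    (he₂ : ∀ (t : T) (n : N.subgroupOf Γ), e (t, some n) = (((n : Γ) * t * w : Γ) : Γ ⧸ N.subgroupOf Γ)) (𝓕 : Set N) (x : G) :
    ∑' p : ↥T × Option ↥(N.subgroupOf Γ), ∫⁻ u in 𝓕, ‖Φ (x * (u : G)⁻¹ * p.2.elim ((p.1 : Γ) : G) fun n => ((n : Γ) : G) * ((p.1 : Γ) : G) * (w : G))‖ₑ ∂νN =
      ∫⁻ u in 𝓕, (∑' q : Γ ⧸ N.subgroupOf Γ, ‖Φ (x * (u : G)⁻¹ * (q.out : G))‖ₑ) ∂νN := by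
  have hm : ∀ y : G, Measurable fun u : N => ‖Φ (x * (u : G)⁻¹ * y)‖ₑ := fun y =>
    (hΦm.comp ((measurable_const.mul measurable_subtype_coe.inv).mul measurable_const)).enorm
  have hton : ∫⁻ u in 𝓕, (∑' q : Γ ⧸ N.subgroupOf Γ, ‖Φ (x * (u : G)⁻¹ * (q.out : G))‖ₑ) ∂νN =
      ∑' q : Γ ⧸ N.subgroupOf Γ, ∫⁻ u in 𝓕, ‖Φ (x * (u : G)⁻¹ * (q.out : G))‖ₑ ∂νN := lintegral_tsum fun q => (hm _).aemeasurable
  rw [hton, ← e.tsum_eq]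
  refine tsum_congr fun p => lintegral_congr fun u => ?_
  rw [apply_mul_out_equiv_eq Γ N hΦ e he₁ he₂ (x * (u : G)⁻¹) p]

/-- **THE BIG-CELL INTEGRAND IS INTEGRABLE**: under the finiteness binder, `v ↦ Φ(x v t w₀)` is `ν`-integrable on `N` for every `t ∈ T` (its `[0,∞]` integral is the sub-sum of the
cells `(t, some n)`, ★ p857228 `tsum_setLIntegral_bigCell_eq`). [cite: MoeglinWaldspurger1995, II.1.7] -/
theorem integrable_bigCell [Countable (Γ ⧸ N.subgroupOf Γ)] {Φ : G → ℂ} (hΦm : Measurable Φ) (hΦ : ∀ (g : G) (n : N), Φ (g * n) = Φ g)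
    {T : Subgroup Γ} {w : Γ} (e : ↥T × Option ↥(N.subgroupOf Γ) ≃ Γ ⧸ N.subgroupOf Γ) (he₁ : ∀ t : T, e (t, none) = ((t : Γ) : Γ ⧸ N.subgroupOf Γ))
    (he₂ : ∀ (t : T) (n : N.subgroupOf Γ), e (t, some n) = (((n : Γ) * t * w : Γ) : Γ ⧸ N.subgroupOf Γ))
    {𝓕 : Set N} (h𝓕 : IsFundamentalDomain (Γ.subgroupOf N) 𝓕 νN) (x : G)
    (hfin : ∫⁻ u in 𝓕, (∑' q : Γ ⧸ N.subgroupOf Γ, ‖Φ (x * (u : G)⁻¹ * (q.out : G))‖ₑ) ∂νN < ∞) (t : T) :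
    Integrable (fun v : N => Φ (x * (v : G) * ((t : Γ) : G) * (w : G))) νN := by
  haveI : Countable (Γ.subgroupOf N) :=
    Function.Injective.countable (f := fun δ : Γ.subgroupOf N => (⟨((δ : N) : G), δ.2⟩ : Γ))
      fun a b h => Subtype.ext (Subtype.ext (congrArg (fun z : Γ => (z : G)) h))
  refine ⟨(hΦm.comp (((measurable_const.mul measurable_subtype_coe).mul measurable_const).mul measurable_const)).aestronglyMeasurable, ?_⟩
  rw [hasFiniteIntegral_iff_enorm]
  -- `∫⁻_N ‖Φ(x v t w)‖ₑ = Σ'_δ ∫⁻_𝓕 ‖Φ(x u⁻¹ δ t w)‖ₑ ≤ Σ'_p L p = hfin`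
  have h1 : ∫⁻ v : N, ‖Φ (x * (v : G) * ((t : Γ) : G) * (w : G))‖ₑ ∂νN =
      ∑' δ : Γ.subgroupOf N, ∫⁻ u in 𝓕, ‖Φ (x * (u : G)⁻¹ * ((δ : N) : G) * (((t : Γ) : G) * (w : G)))‖ₑ ∂νN := by
    rw [tsum_setLIntegral_bigCell_eq Γ N νN (fun g => ‖Φ g‖ₑ) h𝓕 x (((t : Γ) : G) * (w : G))]
    simp only [mul_assoc]
  have h2 : ∑' δ : Γ.subgroupOf N, ∫⁻ u in 𝓕, ‖Φ (x * (u : G)⁻¹ * ((δ : N) : G) * (((t : Γ) : G) * (w : G)))‖ₑ ∂νN =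
      ∑' n : N.subgroupOf Γ, ∫⁻ u in 𝓕, ‖Φ (x * (u : G)⁻¹ * ((⟨t, some n⟩ : ↥T × Option ↥(N.subgroupOf Γ)).2.elim ((t : Γ) : G)
        fun n => ((n : Γ) : G) * ((t : Γ) : G) * (w : G)))‖ₑ ∂νN := by
    rw [← tsum_subgroupOf_swap Γ N (fun y => ∫⁻ u in 𝓕, ‖Φ (x * (u : G)⁻¹ * y * (((t : Γ) : G) * (w : G)))‖ₑ ∂νN)]
    refine tsum_congr fun n => ?_
    simp only [Option.elim, mul_assoc]
  rw [h1, h2]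
  refine lt_of_le_of_lt (ENNReal.tsum_comp_le_tsum_of_injective (f := fun n : N.subgroupOf Γ => ((t, some n) : ↥T × Option ↥(N.subgroupOf Γ)))
    (fun a b h => by simpa using h) (fun p : ↥T × Option ↥(N.subgroupOf Γ) =>
      ∫⁻ u in 𝓕, ‖Φ (x * (u : G)⁻¹ * p.2.elim ((p.1 : Γ) : G) fun n => ((n : Γ) : G) * ((p.1 : Γ) : G) * (w : G))‖ₑ ∂νN)) ?_
  rw [tsum_lintegral_cells_eq Γ N νN hΦm hΦ e he₁ he₂ 𝓕 x]
  exact hfin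

/-- **THE CONSTANT TERM OF A `ℂ`-VALUED PSEUDO-EISENSTEIN SERIES ALONG ITS OWN RANK-ONE RADICAL** [MW1995 II.1.7]: under the finiteness binder
`∫⁻_{u∈𝓕} θ_{‖Φ‖}(x u⁻¹) dν < ∞`,
  `∫_{u ∈ 𝓕} θ_Φ(x u⁻¹) dν(u) = (ν 𝓕).toReal • Σ'_{t ∈ T} Φ(x t) + Σ'_{t ∈ T} ∫_N Φ(x v t w₀) dν(v)`,
both `t`-families being summable (the second by `integrable_bigCell` and the bookkeeping of §1).  `θ_Φ(g) = Σ'_{q ∈ Γ⧸Γ∩N} Φ(g q̃)`; hypotheses as in ★ p857228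
`setLIntegral_tsum_quotient_eq` (the `[0,∞]` twin). [cite: MoeglinWaldspurger1995, II.1.7] [cite: Garrett2018, §1.9] -/
theorem setIntegral_tsum_quotient_eq [Countable (Γ ⧸ N.subgroupOf Γ)] {Φ : G → ℂ} (hΦm : Measurable Φ) (hΦ : ∀ (g : G) (n : N), Φ (g * n) = Φ g)
    {T : Subgroup Γ} (hT : ∀ t ∈ T, ∀ n : N, ((t : G))⁻¹ * (n : G) * (t : G) ∈ N) {w : Γ}
    (e : ↥T × Option ↥(N.subgroupOf Γ) ≃ Γ ⧸ N.subgroupOf Γ) (he₁ : ∀ t : T, e (t, none) = ((t : Γ) : Γ ⧸ N.subgroupOf Γ))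
    (he₂ : ∀ (t : T) (n : N.subgroupOf Γ), e (t, some n) = (((n : Γ) * t * w : Γ) : Γ ⧸ N.subgroupOf Γ))
    {𝓕 : Set N} (h𝓕 : IsFundamentalDomain (Γ.subgroupOf N) 𝓕 νN) (x : G)
    (hfin : ∫⁻ u in 𝓕, (∑' q : Γ ⧸ N.subgroupOf Γ, ‖Φ (x * (u : G)⁻¹ * (q.out : G))‖ₑ) ∂νN < ∞) :
    ∫ u in 𝓕, (∑' q : Γ ⧸ N.subgroupOf Γ, Φ (x * (u : G)⁻¹ * (q.out : G))) ∂νN =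
      (νN 𝓕).toReal • (∑' t : T, Φ (x * ((t : Γ) : G))) + ∑' t : T, ∫ v : N, Φ (x * (v : G) * ((t : Γ) : G) * (w : G)) ∂νN := by
  haveI : Countable (Γ.subgroupOf N) :=
    Function.Injective.countable (f := fun δ : Γ.subgroupOf N => (⟨((δ : N) : G), δ.2⟩ : Γ))
      fun a b h => Subtype.ext (Subtype.ext (congrArg (fun z : Γ => (z : G)) h))
  haveI : MeasurableConstSMul (Γ.subgroupOf N) N := ⟨fun δ => measurable_const_mul (δ : N)⟩
  have hmeas : ∀ y : G, Measurable fun u : N => Φ (x * (u : G)⁻¹ * y) := fun y =>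
    hΦm.comp ((measurable_const.mul measurable_subtype_coe.inv).mul measurable_const)
  -- the cell integrals
  set I : ↥T × Option ↥(N.subgroupOf Γ) → ℂ := fun p =>
    ∫ u in 𝓕, Φ (x * (u : G)⁻¹ * p.2.elim ((p.1 : Γ) : G) fun n => ((n : Γ) : G) * ((p.1 : Γ) : G) * (w : G)) ∂νN with hI_def
  -- (A) the `q`-sum is absolutely convergent: integral of the sum = sum of the integrals
  have hton : ∫⁻ u in 𝓕, (∑' q : Γ ⧸ N.subgroupOf Γ, ‖Φ (x * (u : G)⁻¹ * (q.out : G))‖ₑ) ∂νN =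
      ∑' q : Γ ⧸ N.subgroupOf Γ, ∫⁻ u in 𝓕, ‖Φ (x * (u : G)⁻¹ * (q.out : G))‖ₑ ∂νN := lintegral_tsum fun q => (hmeas _).enorm.aemeasurable
  have hA : ∫ u in 𝓕, (∑' q : Γ ⧸ N.subgroupOf Γ, Φ (x * (u : G)⁻¹ * (q.out : G))) ∂νN =
      ∑' q : Γ ⧸ N.subgroupOf Γ, ∫ u in 𝓕, Φ (x * (u : G)⁻¹ * (q.out : G)) ∂νN :=
    integral_tsum (fun q => (hmeas _).aestronglyMeasurable) (by rw [← hton]; exact hfin.ne)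
  -- (B) reindex by the cells
  have hB : ∑' q : Γ ⧸ N.subgroupOf Γ, ∫ u in 𝓕, Φ (x * (u : G)⁻¹ * (q.out : G)) ∂νN = ∑' p, I p := by
    rw [← e.tsum_eq]
    refine tsum_congr fun p => ?_
    rw [hI_def]
    refine integral_congr_ae (Filter.Eventually.of_forall fun u => ?_)
    exact apply_mul_out_equiv_eq Γ N hΦ e he₁ he₂ (x * (u : G)⁻¹) p
  -- (C) the cell integrals are summable
  have hI : Summable I := by
    refine Summable.of_enorm (ne_of_lt (lt_of_le_of_lt (ENNReal.tsum_le_tsum (g := fun p : ↥T × Option ↥(N.subgroupOf Γ) =>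
      ∫⁻ u in 𝓕, ‖Φ (x * (u : G)⁻¹ * p.2.elim ((p.1 : Γ) : G) fun n => ((n : Γ) : G) * ((p.1 : Γ) : G) * (w : G))‖ₑ ∂νN) fun p => ?_) ?_))
    · rw [hI_def]; exact enorm_integral_le_lintegral_enorm _
    · rw [tsum_lintegral_cells_eq Γ N νN hΦm hΦ e he₁ he₂ 𝓕 x]; exact hfin
  -- (D) the small cell and the big cell
  have hsmall : ∀ t : T, I (t, none) = (νN 𝓕).toReal • Φ (x * ((t : Γ) : G)) := fun t => by
    rw [hI_def]
    have hpt : ∀ u : N, Φ (x * (u : G)⁻¹ * ((⟨t, none⟩ : ↥T × Option ↥(N.subgroupOf Γ)).2.elim ((t : Γ) : G) fun n => ((n : Γ) : G) * ((t : Γ) : G) * (w : G))) =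
        Φ (x * ((t : Γ) : G)) := fun u => by
      have h1 : x * (u : G)⁻¹ * ((t : Γ) : G) = x * ((t : Γ) : G) * ((((t : Γ) : G))⁻¹ * ((u⁻¹ : N) : G) * ((t : Γ) : G)) := by rw [Subgroup.coe_inv]; group
      change Φ (x * (u : G)⁻¹ * ((t : Γ) : G)) = _
      rw [h1]
      exact hΦ _ ⟨_, hT t t.2 u⁻¹⟩
    simp_rw [hpt]
    exact setIntegral_const _
  have hbig : ∀ t : T, ∑' n : N.subgroupOf Γ, I (t, some n) = ∫ v : N, Φ (x * (v : G) * ((t : Γ) : G) * (w : G)) ∂νN := fun t => by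
    -- the integrand on `N` and its integrability
    have hint : Integrable (fun v : N => Φ (x * (v : G)⁻¹ * (((t : Γ) : G) * (w : G)))) νN := by
      have := (integrable_bigCell Γ N νN hΦm hΦ e he₁ he₂ h𝓕 x hfin t).comp_inv
      refine this.congr (Filter.Eventually.of_forall fun v => ?_)
      simp only [Subgroup.coe_inv, mul_assoc]
    -- `Σ'_{n ∈ Γ∩N ≤ Γ} = Σ'_{δ ∈ Γ∩N ≤ N}`, `δ ↦ δ⁻¹`, periodisation, `v ↦ v⁻¹`
    have hswap : ∑' n : N.subgroupOf Γ, I (t, some n) =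
        ∑' δ : Γ.subgroupOf N, ∫ u in 𝓕, Φ (x * (u : G)⁻¹ * ((δ : N) : G) * (((t : Γ) : G) * (w : G))) ∂νN := by
      rw [← (Equiv.ofBijective _ (bijective_subgroupOf_swap Γ N)).tsum_eq]
      refine tsum_congr fun n => ?_
      rw [hI_def]
      simp only [Equiv.ofBijective_apply, Option.elim, mul_assoc]
    rw [hswap, ← (Equiv.inv (Γ.subgroupOf N)).tsum_eq]
    have hδ : ∀ (δ : Γ.subgroupOf N) (u : N), x * (u : G)⁻¹ * (((Equiv.inv (Γ.subgroupOf N) δ : Γ.subgroupOf N) : N) : G) * (((t : Γ) : G) * (w : G)) =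
        x * (((δ • u : N) : G))⁻¹ * (((t : Γ) : G) * (w : G)) := fun δ u => by
      simp only [Equiv.inv_apply, Subgroup.smul_def, smul_eq_mul, Subgroup.coe_mul, Subgroup.coe_inv, mul_inv_rev, mul_assoc]
    simp_rw [hδ]
    rw [← h𝓕.integral_eq_tsum'' (fun v : N => Φ (x * (v : G)⁻¹ * (((t : Γ) : G) * (w : G)))) hint,
      ← integral_inv_eq_self (fun v : N => Φ (x * (v : G) * ((t : Γ) : G) * (w : G))) νN]
    refine integral_congr_ae (Filter.Eventually.of_forall fun v => ?_)
    simp only [Subgroup.coe_inv, mul_assoc]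
  -- (E) summability of the two `t`-families
  have h1 : Summable fun t : T => I (t, none) := hI.comp_injective fun a b h => (Prod.mk.injEq _ _ _ _ ▸ h :).1
  have h2 : Summable fun t : T => ∑' n : N.subgroupOf Γ, I (t, some n) := by
    refine (hI.prod.sub h1).congr fun t => ?_
    change ∑' o, I (t, o) - I (t, none) = _
    rw [tsum_option_eq_of_summable _ (hI.prod_factor t), add_sub_cancel_left]
  -- (F) assemble
  rw [hA, hB, hI.tsum_prod' fun t => hI.prod_factor t]
  have hD : ∀ t : T, ∑' o, I (t, o) = I (t, none) + ∑' n : N.subgroupOf Γ, I (t, some n) := fun t => tsum_option_eq_of_summable _ (hI.prod_factor t)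
  simp_rw [hD]
  rw [h1.tsum_add h2]
  simp_rw [hsmall, hbig]
  rw [tsum_const_smul'']

/-- **THE SAME ON `X = G ⧸ Γ`** (`θ_Φ(y) = Σ'_q Φ(ỹ q̃)` through `Quotient.out`, ★ F2a `tsum_quotient_mul_coe_eq`): the left side is VERBATIM the ★ `ConstantTermVanishes`
integrand of `θ_Φ` at `x`. [cite: MoeglinWaldspurger1995, II.1.7] -/
theorem setIntegral_tsum_quotient_mk_eq [Countable (Γ ⧸ N.subgroupOf Γ)] {Φ : G → ℂ} (hΦm : Measurable Φ) (hΦ : ∀ (g : G) (n : N), Φ (g * n) = Φ g)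
    {T : Subgroup Γ} (hT : ∀ t ∈ T, ∀ n : N, ((t : G))⁻¹ * (n : G) * (t : G) ∈ N) {w : Γ}
    (e : ↥T × Option ↥(N.subgroupOf Γ) ≃ Γ ⧸ N.subgroupOf Γ) (he₁ : ∀ t : T, e (t, none) = ((t : Γ) : Γ ⧸ N.subgroupOf Γ))
    (he₂ : ∀ (t : T) (n : N.subgroupOf Γ), e (t, some n) = (((n : Γ) * t * w : Γ) : Γ ⧸ N.subgroupOf Γ))
    {𝓕 : Set N} (h𝓕 : IsFundamentalDomain (Γ.subgroupOf N) 𝓕 νN) (x : G)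
    (hfin : ∫⁻ u in 𝓕, (∑' q : Γ ⧸ N.subgroupOf Γ, ‖Φ (x * (u : G)⁻¹ * (q.out : G))‖ₑ) ∂νN < ∞) :
    ∫ u in 𝓕, (∑' q : Γ ⧸ N.subgroupOf Γ, Φ (((QuotientGroup.mk (x * (u : G)⁻¹) : G ⧸ Γ).out) * (q.out : G))) ∂νN =
      (νN 𝓕).toReal • (∑' t : T, Φ (x * ((t : Γ) : G))) + ∑' t : T, ∫ v : N, Φ (x * (v : G) * ((t : Γ) : G) * (w : G)) ∂νN := by
  have hout : ∀ u : N, ∑' q : Γ ⧸ N.subgroupOf Γ, Φ (((QuotientGroup.mk (x * (u : G)⁻¹) : G ⧸ Γ).out) * (q.out : G)) =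
      ∑' q : Γ ⧸ N.subgroupOf Γ, Φ (x * (u : G)⁻¹ * (q.out : G)) := fun u => by
    obtain ⟨γ₀, hγ₀⟩ := QuotientGroup.mk_out_eq_mul Γ (x * (u : G)⁻¹)
    rw [hγ₀]
    exact tsum_quotient_mul_coe_eq Γ N hΦ (x * (u : G)⁻¹) γ₀
  simp_rw [hout]
  exact setIntegral_tsum_quotient_eq Γ N νN hΦm hΦ hT e he₁ he₂ h𝓕 x hfin

end ConstantTermC

end Summit.HodgeConjecture.HodgeConjecture.Cruxes.H413.K2E1PseudoEisensteinConstantTermC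

end
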